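import Summits.NavierStokesRegularity.NavierStokesRegularity.Theses.AxisymmetricExtremality
import Summits.NavierStokesRegularity.NavierStokesRegularity.Theorems.AxisymmetricExtremalityAxisymmetricKatoGlobalStubSeregin2020TypeIILemma22EnergySlice
import HarnessLib

/-!
# Seregin 2020, Lemma 2.2 (after Nazarov–Uraltseva 2012): the energy inequality for classical
# SUPERsolutions of `∂ₜΦ + (U + 2x'/|x'|²)·∇Φ - ΔΦ ≥ 0` off the axis, with a divergence-free drift

Helper toward the stub `stub_seregin2020TypeII` of the crux `AxisymmetricKatoGlobal` (= the named
fact `Literature.Analysis.FluidPDE.Seregin2020_axisymmetricSingularPoint_typeII`, G. Seregin,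
Anal. Math. Phys. 10 (2020) Paper 46 = arXiv:2006.04140, Thm 2.1; remaining ingredient: Lemma 2.2,
the Nazarov–Uraltseva propagation of a lower bound from the axis, in the rendered form `hWH` of
`ae_swirl_eq_zero_of_weakHarnack` WITH THE SIGN OF (2.12) CORRECTED TO `≥ 0`, see
`…Lemma22RenderedSign`). First genuine piece of its proof: the parabolic energy (Caccioppoli)
inequality from which every step of Nazarov–Uraltseva 2012, §3 starts ((3.2) with `φ(τ) = τ₊^p`
for the local maximum estimate of Lemma 3.1, (3.9) with `(V - k)₋` for Lemmata 3.2, 3.3), here for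
cut-offs supported OFF the axis (the passage of the cut-off through the regular part of the axis,
where `Φ ≥ k` kills `H(Φ)`, and the excision of the `𝒫¹`-null singular set are the next pieces):

* `supersolution_energy_ineq_offAxis` — on a slab `]lo, hi[ × O`, `O` open off the axis, for `Φ`
  with the localised class-𝒱 clauses of `hWH` (continuous, `C²` slices, `∇Φ` and the classical
  `∂ₜΦ` jointly continuous), a drift `U` (jointly continuous, `C¹` slices, `div U = 0`), the
  SUPERSOLUTION inequality `0 ≤ ∂ₜΦ + DΦ[U] + (2/ϱ)∂_ϱΦ - ΔΦ`, `H ∈ C²` with `H' ≤ 0`,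
  `Θ ∈ C¹_c(O)`, `η ∈ C¹`, `η ≥ 0`, `lo < t₁ ≤ t < hi`:
  `η(t)M(t) - η(t₁)M(t₁) ≤ ∫_{t₁}^t (η(-(G_H + T₁) + T_U + T_b) + η' M) ds`
  (`M = ∫H(Φ)Θ²`, `G_H = ∫H''(Φ)|∇Φ|²Θ²`, `T₁ = ∫H'(Φ)⟪∇Φ,∇Θ²⟫`, `T_U = ∫H(Φ)⟪U,∇Θ²⟫`,
  `T_b = ∫(2/ϱ)H(Φ)∂_ϱ(Θ²)`: both drifts sit on the cut-off, by `div U = 0`, `div(2x'/|x'|²) = 0`);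
* `supersolution_energy_ineq_offAxis_absorbed` — with `H, H'' ≥ 0`, `H'² ≤ 2HH''` (e.g.
  `H = (k-τ)₊^p`, `p ≥ 2`): `η(t)M(t) + ½∫ηG_H ≤ η(t₁)M(t₁) + ∫(4ηP + ηT_U + ηT_b + |η'|M)`,
  `P = ∫H(Φ)|∇Θ|²` — Nazarov–Uraltseva's (3.9) before the choice of `ζ`.

Proof: FTC in time off the axis, the integrated chain rule
(`integral_comp_mul_sub_eq_integral_integral_ae`), the pointwise inequality
`H'(Φ)∂ₜΦ ≤ H'(Φ)(ΔΦ - DΦ[U] - (2/ϱ)∂_ϱΦ)` (`H' ≤ 0`, supersolution), the slice identity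
`drift_energy_slice_identity`, and `Seregin2020.neg_cross_le_pointwise` for the absorption.

## References

* G. Seregin, Anal. Math. Phys. 10 (2020), Paper 46 = arXiv:2006.04140, Lemma 2.2 (arXiv p. 8).
  [Seregin2020]
* A. I. Nazarov, N. N. Uraltseva, St. Petersburg Math. J. 23 (2012) 93–115 = arXiv:1011.1888,
  §3 (3.2), (3.9), Remark 9; §4 Lemma 4.2. [NazarovUraltseva2012]
-/


-- the problem directory repeats the summit name (D-0017); core's `dupNamespace` linter fires
set_option linter.dupNamespace false

noncomputable section

open MeasureTheory Set Function Filter Topology TopologicalSpace Metric WithLp intervalIntegral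
open scoped NNReal ENNReal InnerProductSpace RealInnerProductSpace Laplacian

namespace Summit.NavierStokesRegularity.NavierStokesRegularity.Theorems.AxisymmetricKatoGlobal.EulerScaling

open Literature.Analysis.FluidPDE Literature.Analysis.FluidPDE.Seregin2020

/-- **The energy inequality for classical supersolutions of `∂ₜΦ + (U + 2x'/|x'|²)·∇Φ - ΔΦ ≥ 0`
off the axis, with the cross term** (Nazarov–Uraltseva 2012, §3: (3.2) and (3.9) before the
estimates; Seregin 2020, proof of Lemma 2.2). Setting: a slab `]lo, hi[ × O` with `O` open and
off the axis; `Φ` continuous on the slab with `C²` slices, jointly continuous gradient, a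
classical time derivative jointly continuous on the slab; a drift `U` jointly continuous with `C¹`
divergence-free slices; the supersolution inequality `0 ≤ ∂ₜΦ + DΦ[U] + (2/ϱ)∂_ϱΦ - ΔΦ` on the
slab; `H ∈ C²` NONINCREASING; `Θ ∈ C¹_c`, `tsupport Θ ⊆ O`; `η ∈ C¹`, `η ≥ 0`; `lo < t₁ ≤ t < hi`.
Conclusion: `η(t)M(t) - η(t₁)M(t₁) ≤ ∫_{t₁}^t (η(s)(-(G_H + T₁) + T_U + T_b)(s) + η'(s)M(s)) ds` with
`M = ∫H(Φ)Θ²`, `G_H = ∫H''(Φ)|∇Φ|²Θ²`, `T₁ = ∫H'(Φ)⟪∇Φ, ∇Θ²⟫`, `T_U = ∫H(Φ)⟪U, ∇Θ²⟫`,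
`T_b = ∫(2/ϱ)H(Φ)∂_ϱ(Θ²)`. [cite: NazarovUraltseva2012, §3 (3.2) and (3.9)] -/
theorem supersolution_energy_ineq_offAxis : ∀ (O : Set (EuclideanSpace ℝ (Fin 3))), IsOpen O →
    (∀ x ∈ O, cylRadius x ≠ 0) → ∀ (lo hi : ℝ)
    (Φ : ℝ → EuclideanSpace ℝ (Fin 3) → ℝ) (U : ℝ → EuclideanSpace ℝ (Fin 3) → EuclideanSpace ℝ (Fin 3)),
    ContinuousOn (uncurry Φ) (Ioo lo hi ×ˢ O) →
    (∀ z ∈ Ioo lo hi ×ˢ O, ContDiffAt ℝ 2 (Φ z.1) z.2) →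
    ContinuousOn (fun z : ℝ × EuclideanSpace ℝ (Fin 3) => fderiv ℝ (Φ z.1) z.2) (Ioo lo hi ×ˢ O) →
    (∀ z ∈ Ioo lo hi ×ˢ O, DifferentiableAt ℝ (fun r => Φ r z.2) z.1) →
    ContinuousOn (fun z : ℝ × EuclideanSpace ℝ (Fin 3) => deriv (fun r => Φ r z.2) z.1) (Ioo lo hi ×ˢ O) →
    ContinuousOn (uncurry U) (Ioo lo hi ×ˢ O) →
    (∀ z ∈ Ioo lo hi ×ˢ O, ContDiffAt ℝ 1 (U z.1) z.2) →
    (∀ z ∈ Ioo lo hi ×ˢ O, VectorCalculus.divergence (U z.1) z.2 = 0) →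
    (∀ z ∈ Ioo lo hi ×ˢ O, 0 ≤ deriv (fun r => Φ r z.2) z.1 + fderiv ℝ (Φ z.1) z.2 (U z.1 z.2) +
      2 / cylRadius z.2 * partialDeriv (eR z.2) (Φ z.1) z.2 - (Laplacian.laplacian (Φ z.1)) z.2) →
    ∀ (H : ℝ → ℝ), ContDiff ℝ 2 H → (∀ v, deriv H v ≤ 0) →
    ∀ (Θ : EuclideanSpace ℝ (Fin 3) → ℝ), ContDiff ℝ 1 Θ → HasCompactSupport Θ → tsupport Θ ⊆ O →
    ∀ (η : ℝ → ℝ), ContDiff ℝ 1 η → (∀ s, 0 ≤ η s) →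
    ∀ (t₁ t : ℝ), lo < t₁ → t₁ ≤ t → t < hi →
    ∀ (M GH T₁ TU Tb : ℝ → ℝ),
    (∀ s, M s = ∫ x, H (Φ s x) * Θ x ^ 2) →
    (∀ s, GH s = ∫ x, deriv (deriv H) (Φ s x) * ‖gradient (Φ s) x‖ ^ 2 * Θ x ^ 2) →
    (∀ s, T₁ s = ∫ x, deriv H (Φ s x) * inner ℝ (gradient (Φ s) x) (gradient (fun y => Θ y ^ 2) x)) →
    (∀ s, TU s = ∫ x, H (Φ s x) * inner ℝ (U s x) (gradient (fun y => Θ y ^ 2) x)) →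
    (∀ s, Tb s = ∫ x, 2 / cylRadius x * (H (Φ s x) * fderiv ℝ (fun y => Θ y ^ 2) x (eR x))) →
    η t * M t - η t₁ * M t₁ ≤
      ∫ s in t₁..t, (η s * (-(GH s + T₁ s) + TU s + Tb s) + deriv η s * M s) := by
  intro O hO hOρ lo hi Φ U hΦc hΦs hΦg hΦt hΦt' hUc hUs hdivU hsup H hH hH' Θ hΘ hΘc hΘO η hη hη0
    t₁ t h1 h1t ht M GH T₁ TU Tb hM hGH hT₁ hTU hTb
  -- notation
  obtain ⟨Dt, hDt⟩ : ∃ Dt : ℝ → EuclideanSpace ℝ (Fin 3) → ℝ, ∀ r x, Dt r x = deriv (fun r => Φ r x) r := ⟨_, fun _ _ => rfl⟩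
  obtain ⟨D, hD⟩ : ∃ D : ℝ → ℝ, ∀ s, D s = ∫ x, deriv H (Φ s x) * deriv (fun r => Φ r x) s * Θ x ^ 2 := ⟨_, fun _ => rfl⟩
  obtain ⟨Pf, hPf⟩ : ∃ Pf : ℝ → ℝ, ∀ s, Pf s = ∫ x, H (Φ s x) * ‖gradient Θ x‖ ^ 2 := ⟨_, fun _ => rfl⟩
  set K : Set (EuclideanSpace ℝ (Fin 3)) := tsupport Θ with hKdef
  obtain ⟨hK, hKm⟩ : IsCompact K ∧ MeasurableSet K := ⟨hΘc, hΘc.isClosed.measurableSet⟩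
  have hIcc : Icc t₁ t ⊆ Ioo lo hi := fun r hr => ⟨lt_of_lt_of_le h1 hr.1, lt_of_le_of_lt hr.2 ht⟩
  have hΘ0 : ∀ x, x ∉ K → Θ x = 0 := fun x hx => image_eq_zero_of_notMem_tsupport hx
  have hH1 : ContDiff ℝ 1 H := hH.of_le one_le_two
  have hHd' : ContDiff ℝ 1 (deriv H) := by
    have h2' : ContDiff ℝ (1 + 1) H := by rw [one_add_one_eq_two]; exact hH
    exact h2'.deriv'
  -- continuity in time of the slice functionals
  obtain ⟨cM, cGH, cT₁, -, cTU, cTb, cD⟩ := continuousOn_drift_sliceFunctionals O hO hOρ lo hi Φ U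
    hΦc hΦg hΦt' hUc H hH Θ hΘ hΘc hΘO M GH T₁ Pf TU Tb D hM hGH hT₁ hPf hTU hTb hD
  -- (1) the time-integrated equation `Φ(s, x) = Φ(t₁, x) + ∫_{t₁}^s ∂ₜΦ`, for every `x ∈ K`
  have hderiv : ∀ x ∈ O, ∀ r ∈ Ioo lo hi, HasDerivAt (fun r => Φ r x) (Dt r x) r := by
    intro x hx r hr
    rw [hDt]
    exact (hΦt (r, x) ⟨hr, hx⟩).hasDerivAt
  have hDtc : ∀ x ∈ O, ContinuousOn (fun r => Dt r x) (Ioo lo hi) := by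
    intro x hx
    refine (ContinuousOn.comp (g := fun z : ℝ × EuclideanSpace ℝ (Fin 3) => deriv (fun r => Φ r z.2) z.1)
      (f := fun r : ℝ => ((r, x) : ℝ × EuclideanSpace ℝ (Fin 3))) hΦt' (continuous_id.prodMk continuous_const).continuousOn
      fun r hr => ⟨hr, hx⟩).congr fun r _ => hDt r x
  have hgn : ∀ᵐ x ∂(volume.restrict K), IntervalIntegrable (fun r => Dt r x) volume t₁ t ∧
      ∀ s ∈ Icc t₁ t, Φ s x = Φ t₁ x + ∫ r in t₁..s, Dt r x := by
    rw [ae_restrict_iff' hKm]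
    refine ae_of_all _ fun x hx => ?_
    have hxO : x ∈ O := hΘO hx
    have hsub : uIcc t₁ t ⊆ Ioo lo hi := by rw [uIcc_of_le h1t]; exact hIcc
    refine ⟨((hDtc x hxO).mono hsub).intervalIntegrable, fun s hs => ?_⟩
    have hsub' : uIcc t₁ s ⊆ Ioo lo hi := by
      rw [uIcc_of_le hs.1]
      exact fun r hr => hIcc ⟨hr.1, hr.2.trans hs.2⟩
    have hFTC := integral_eq_sub_of_hasDerivAt (fun r hr => hderiv x hxO r (hsub' hr))
      (((hDtc x hxO).mono hsub').intervalIntegrable)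
    rw [hFTC]
    ring
  -- (2) integrability of the space–time integrand of the chain rule on `(t₁, t] × K`
  have cI : ContinuousOn (fun p : ℝ × EuclideanSpace ℝ (Fin 3) =>
      (deriv H (Φ p.1 p.2) * Dt p.1 p.2 * η p.1 + H (Φ p.1 p.2) * deriv η p.1) * Θ p.2 ^ 2) (Ioo lo hi ×ˢ O) := by
    have c1 := hHd'.continuous.comp_continuousOn hΦc
    have c2 := hH.continuous.comp_continuousOn hΦc
    have c3 : Continuous fun z : ℝ × EuclideanSpace ℝ (Fin 3) => η z.1 := hη.continuous.comp continuous_fst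
    have c4 : Continuous fun z : ℝ × EuclideanSpace ℝ (Fin 3) => deriv η z.1 := (hη.continuous_deriv le_rfl).comp continuous_fst
    have c5 : Continuous fun z : ℝ × EuclideanSpace ℝ (Fin 3) => Θ z.2 ^ 2 := (hΘ.continuous.comp continuous_snd).pow 2
    have cDt : ContinuousOn (fun z : ℝ × EuclideanSpace ℝ (Fin 3) => Dt z.1 z.2) (Ioo lo hi ×ˢ O) :=
      hΦt'.congr fun z _ => hDt z.1 z.2
    exact (((c1.mul cDt).mul c3.continuousOn).add (c2.mul c4.continuousOn)).mul c5.continuousOn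
  have hint : Integrable (fun p : ℝ × EuclideanSpace ℝ (Fin 3) =>
      (deriv H (Φ p.1 p.2) * Dt p.1 p.2 * η p.1 + H (Φ p.1 p.2) * deriv η p.1) * Θ p.2 ^ 2)
      ((volume.restrict (Ioc t₁ t)).prod (volume.restrict K)) := by
    have hsub : Icc t₁ t ×ˢ K ⊆ Ioo lo hi ×ˢ O := prod_mono hIcc hΘO
    have hcpt : IsCompact (Icc t₁ t ×ˢ K) := isCompact_Icc.prod hK
    have hI := (cI.mono hsub).integrableOn_compact hcpt
      (μ := ((volume : Measure ℝ).prod (volume : Measure (EuclideanSpace ℝ (Fin 3)))))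
    have hI' := hI.mono_set (prod_mono Ioc_subset_Icc_self Subset.rfl)
    rw [IntegrableOn, ← Measure.prod_restrict] at hI'
    exact hI'
  -- (3) the integrated chain rule, with the restriction to `K` removed
  have hchain := integral_comp_mul_sub_eq_integral_integral_ae (μ := volume.restrict K)
    (g := fun r x => Φ r x) (n := Dt) h1t hgn hH1 hη (fun x => Θ x ^ 2) hint
  have eLHS : ∫ x in K, (H (Φ t x) * η t - H (Φ t₁ x) * η t₁) * Θ x ^ 2 = η t * M t - η t₁ * M t₁ := by
    rw [setIntegral_eq_integral_of_forall_compl_eq_zero fun x hx => by simp [hΘ0 x hx], hM t, hM t₁,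
      ← MeasureTheory.integral_const_mul, ← MeasureTheory.integral_const_mul]
    have iHM : ∀ r ∈ Icc t₁ t, ∀ c : ℝ, Integrable fun x => c * (H (Φ r x) * Θ x ^ 2) := fun r hr c =>
      ((continuous_integrable_of_continuousOn_of_eq_zero hO hK hΘO ((hH.continuous.comp_continuousOn
        (hΦc.comp (continuous_const.prodMk continuous_id).continuousOn fun x hx => ⟨hIcc hr, hx⟩)).mul
        (hΘ.continuous.pow 2).continuousOn) (fun x hx => by simp [hΘ0 x hx])).2).const_mul _
    have iA := iHM t ⟨h1t, le_rfl⟩ (η t)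
    have iB := iHM t₁ ⟨le_rfl, h1t⟩ (η t₁)
    rw [← MeasureTheory.integral_sub iA iB]
    refine MeasureTheory.integral_congr_ae (ae_of_all _ fun x => ?_)
    beta_reduce
    ring
  have eRHS : ∀ s, ∫ x in K, (deriv H (Φ s x) * Dt s x * η s + H (Φ s x) * deriv η s) * Θ x ^ 2 =
      ∫ x, (deriv H (Φ s x) * Dt s x * η s + H (Φ s x) * deriv η s) * Θ x ^ 2 := fun s =>
    setIntegral_eq_integral_of_forall_compl_eq_zero fun x hx => by simp [hΘ0 x hx]
  rw [eLHS] at hchain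
  simp_rw [eRHS] at hchain
  -- (4) the slice inequality on `[t₁, t]`: supersolution, `H' ≤ 0`, `η ≥ 0`, then the slice identity
  have hslice : ∀ s ∈ Icc t₁ t,
      ∫ x, (deriv H (Φ s x) * Dt s x * η s + H (Φ s x) * deriv η s) * Θ x ^ 2 ≤
        η s * (-(GH s + T₁ s) + TU s + Tb s) + deriv η s * M s := by
    intro s hs
    have hsI : s ∈ Ioo lo hi := hIcc hs
    have hF2 : ContDiffOn ℝ 2 (Φ s) O := fun x hx => (hΦs (s, x) ⟨hsI, hx⟩).contDiffWithinAt
    have hX1 : ContDiffOn ℝ 1 (U s) O := fun x hx => (hUs (s, x) ⟨hsI, hx⟩).contDiffWithinAt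
    have hdivX : ∀ x ∈ O, VectorCalculus.divergence (U s) x = 0 := fun x hx => hdivU (s, x) ⟨hsI, hx⟩
    have hid := drift_energy_slice_identity O hO hOρ (Φ s) hF2 (U s) hX1 hdivX H hH Θ hΘ hΘc hΘO
    -- continuity on `O` at the fixed time `s`
    have cF : ContinuousOn (Φ s) O := hF2.continuousOn
    have cDts : ContinuousOn (fun x => Dt s x) O :=
      (hΦt'.comp (continuous_const.prodMk continuous_id).continuousOn fun x hx => ⟨hsI, hx⟩).congr fun x _ => hDt s x
    have cUs : ContinuousOn (U s) O := hX1.continuousOn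
    have cΔ : ContinuousOn (Δ (Φ s)) O := continuousOn_laplacian_of_contDiffOn hO hF2
    have cfd : ContinuousOn (fderiv ℝ (Φ s)) O := (hF2.of_le (by norm_cast)).continuousOn_fderiv_of_isOpen hO le_rfl
    have ceR : ContinuousOn eR O := continuousOn_eR_offAxis.mono fun x hx => hOρ x hx
    have cinv : ContinuousOn (fun x => 2 / cylRadius x) O :=
      continuousOn_const.div continuous_cylRadius.continuousOn fun x hx => hOρ x hx
    have cΘ2 : Continuous fun y : EuclideanSpace ℝ (Fin 3) => Θ y ^ 2 := hΘ.continuous.pow 2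
    have cH'F : ContinuousOn (fun x => deriv H (Φ s x)) O := hHd'.continuous.comp_continuousOn cF
    have cHF : ContinuousOn (fun x => H (Φ s x)) O := hH.continuous.comp_continuousOn cF
    -- the classical operator `𝓛Φ = ΔΦ - DΦ[U] - (2/ϱ)∂_ϱΦ` at time `s`
    have cL : ContinuousOn (fun x => (Δ (Φ s)) x - fderiv ℝ (Φ s) x (U s x) -
        2 / cylRadius x * partialDeriv (eR x) (Φ s) x) O := by
      refine (cΔ.sub (cfd.clm_apply cUs)).sub (cinv.mul ?_)
      exact (cfd.clm_apply ceR).congr fun x _ => partialDeriv_apply _ _ _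
    have iL1 : Integrable fun x => deriv H (Φ s x) * ((Δ (Φ s)) x - fderiv ℝ (Φ s) x (U s x) -
        2 / cylRadius x * partialDeriv (eR x) (Φ s) x) * Θ x ^ 2 :=
      (continuous_integrable_of_continuousOn_of_eq_zero hO hK hΘO ((cH'F.mul cL).mul cΘ2.continuousOn)
        (fun x hx => by simp [hΘ0 x hx])).2
    have iL2 : Integrable fun x => H (Φ s x) * Θ x ^ 2 :=
      (continuous_integrable_of_continuousOn_of_eq_zero hO hK hΘO (cHF.mul cΘ2.continuousOn) (fun x hx => by simp [hΘ0 x hx])).2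
    have iL : Integrable fun x => η s * (deriv H (Φ s x) * ((Δ (Φ s)) x - fderiv ℝ (Φ s) x (U s x) -
        2 / cylRadius x * partialDeriv (eR x) (Φ s) x) * Θ x ^ 2) + deriv η s * (H (Φ s x) * Θ x ^ 2) :=
      (iL1.const_mul _).add (iL2.const_mul _)
    have iI : Integrable fun x => (deriv H (Φ s x) * Dt s x * η s + H (Φ s x) * deriv η s) * Θ x ^ 2 :=
      (continuous_integrable_of_continuousOn_of_eq_zero hO hK hΘO
        ((((cH'F.mul cDts).mul continuousOn_const).add (cHF.mul continuousOn_const)).mul cΘ2.continuousOn)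
        (fun x hx => by simp [hΘ0 x hx])).2
    -- pointwise comparison
    have hpt : ∀ x, (deriv H (Φ s x) * Dt s x * η s + H (Φ s x) * deriv η s) * Θ x ^ 2 ≤
        η s * (deriv H (Φ s x) * ((Δ (Φ s)) x - fderiv ℝ (Φ s) x (U s x) -
          2 / cylRadius x * partialDeriv (eR x) (Φ s) x) * Θ x ^ 2) + deriv η s * (H (Φ s x) * Θ x ^ 2) := by
      intro x
      by_cases hx : x ∈ K
      · have hxO : x ∈ O := hΘO hx
        have hL : (Δ (Φ s)) x - fderiv ℝ (Φ s) x (U s x) - 2 / cylRadius x * partialDeriv (eR x) (Φ s) x ≤ Dt s x := by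
          have h := hsup (s, x) ⟨hsI, hxO⟩
          rw [hDt]; simp only at h; linarith
        have hkey : deriv H (Φ s x) * Dt s x ≤ deriv H (Φ s x) * ((Δ (Φ s)) x - fderiv ℝ (Φ s) x (U s x) -
            2 / cylRadius x * partialDeriv (eR x) (Φ s) x) := mul_le_mul_of_nonpos_left hL (hH' _)
        nlinarith [mul_le_mul_of_nonneg_right (mul_le_mul_of_nonneg_left hkey (hη0 s)) (sq_nonneg (Θ x))]
      · simp [hΘ0 x hx]
    have hmono := MeasureTheory.integral_mono iI iL hpt
    have esplit : ∫ x, (η s * (deriv H (Φ s x) * ((Δ (Φ s)) x - fderiv ℝ (Φ s) x (U s x) -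
        2 / cylRadius x * partialDeriv (eR x) (Φ s) x) * Θ x ^ 2) + deriv η s * (H (Φ s x) * Θ x ^ 2)) =
        η s * (∫ x, deriv H (Φ s x) * ((Δ (Φ s)) x - fderiv ℝ (Φ s) x (U s x) -
          2 / cylRadius x * partialDeriv (eR x) (Φ s) x) * Θ x ^ 2) + deriv η s * M s := by
      rw [MeasureTheory.integral_add (iL1.const_mul _) (iL2.const_mul _), MeasureTheory.integral_const_mul,
        MeasureTheory.integral_const_mul, hM s]
    rw [esplit, hid] at hmono
    have eT : (∫ x, (deriv (deriv H) (Φ s x) * ‖gradient (Φ s) x‖ ^ 2 * Θ x ^ 2 +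
        deriv H (Φ s x) * ⟪gradient (Φ s) x, gradient (fun y => Θ y ^ 2) x⟫)) = GH s + T₁ s := by
      have cgF : ContinuousOn (gradient (Φ s)) O := continuousOn_gradient_of_contDiffOn hO (hF2.of_le (by norm_cast))
      have cgΘ2 : Continuous (gradient fun y => Θ y ^ 2) := continuous_gradient_of_contDiff (hΘ.pow 2)
      have hgΘ0 : ∀ x, x ∉ K → gradient (fun y => Θ y ^ 2) x = 0 := fun x hx => gradient_sq_eq_zero_of_notMem hx
      have iGH : Integrable fun x => deriv (deriv H) (Φ s x) * ‖gradient (Φ s) x‖ ^ 2 * Θ x ^ 2 :=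
        (continuous_integrable_of_continuousOn_of_eq_zero hO hK hΘO
          ((((hHd'.continuous_deriv le_rfl).comp_continuousOn cF).mul (cgF.norm.pow 2)).mul cΘ2.continuousOn)
          (fun x hx => by simp [hΘ0 x hx])).2
      have iT₁ : Integrable fun x => deriv H (Φ s x) * ⟪gradient (Φ s) x, gradient (fun y => Θ y ^ 2) x⟫ :=
        (continuous_integrable_of_continuousOn_of_eq_zero hO hK hΘO (cH'F.mul (cgF.inner cgΘ2.continuousOn))
          (fun x hx => by
            show deriv H (Φ s x) * ⟪gradient (Φ s) x, gradient (fun y => Θ y ^ 2) x⟫ = 0; simp [hgΘ0 x hx])).2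
      rw [hGH s, hT₁ s, ← MeasureTheory.integral_add iGH iT₁]
    rw [eT, ← hTU s, ← hTb s] at hmono
    linarith
  -- (5) integrate the slice inequality over `[t₁, t]`
  have hsub : uIcc t₁ t ⊆ Ioo lo hi := by rw [uIcc_of_le h1t]; exact hIcc
  have cη : Continuous η := hη.continuous
  have cη' : Continuous (deriv η) := hη.continuous_deriv le_rfl
  have iRHS : IntervalIntegrable (fun s => η s * (-(GH s + T₁ s) + TU s + Tb s) + deriv η s * M s) volume t₁ t :=
    (((((cGH.add cT₁).neg.add cTU).add cTb).mono hsub).intervalIntegrable.continuousOn_mul cη.continuousOn).add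
      ((cM.mono hsub).intervalIntegrable.continuousOn_mul cη'.continuousOn)
  have cIfun : ContinuousOn (fun s => ∫ x, (deriv H (Φ s x) * Dt s x * η s + H (Φ s x) * deriv η s) * Θ x ^ 2)
      (Ioo lo hi) := by
    have h := continuousOn_integral_slice_of_eq_zero (I := Ioo lo hi) hO hK hΘO
      (Φ := fun p : ℝ × EuclideanSpace ℝ (Fin 3) =>
        (deriv H (Φ p.1 p.2) * Dt p.1 p.2 * η p.1 + H (Φ p.1 p.2) * deriv η p.1) * Θ p.2 ^ 2) cI
      (fun s x hx => by simp [hΘ0 x hx])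
    exact h
  have iLHS : IntervalIntegrable
      (fun s => ∫ x, (deriv H (Φ s x) * Dt s x * η s + H (Φ s x) * deriv η s) * Θ x ^ 2) volume t₁ t :=
    (cIfun.mono hsub).intervalIntegrable
  have hmono := intervalIntegral.integral_mono_on h1t iLHS iRHS fun s hs => hslice s hs
  rw [← hchain] at hmono
  exact hmono

/-- **Nazarov–Uraltseva's energy inequality (3.9) before the choice of the cut-off, for classical
supersolutions of `∂ₜΦ + (U + 2x'/|x'|²)·∇Φ - ΔΦ ≥ 0` off the axis** (the cross term absorbed by
`H'² ≤ 2HH''`, as in the tree's `Seregin2020.swirl_energy_inequality`). In the setting of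
`supersolution_energy_ineq_offAxis` with moreover `H ≥ 0`, `H'' ≥ 0`, `H'² ≤ 2HH''` (e.g.
`H(τ) = (k - τ)₊^p`, `p ≥ 2`): `η(t)M(t) + ½∫_{t₁}^t ηG_H ≤ η(t₁)M(t₁) + ∫_{t₁}^t (4ηP + ηT_U + ηT_b + |η'|M)`,
`P = ∫H(Φ)|∇Θ|²`; for `H = (k-τ)₊²` smoothed this is
`∫(V-k)₋²ζ²|^{t} + ∫∫|∇(V-k)₋|²ζ² ≤ ∫(V-k)₋²ζ²|_{t₁} + ∫∫(V-k)₋²(C|∇ζ|² + ζ|∂ₜζ| + 2bᵢζDᵢζ)` with the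
drifts `b = U + 2x'/|x'|²` on the cut-off. [cite: NazarovUraltseva2012, §3 (3.9)] -/
theorem supersolution_energy_ineq_offAxis_absorbed : ∀ (O : Set (EuclideanSpace ℝ (Fin 3))), IsOpen O →
    (∀ x ∈ O, cylRadius x ≠ 0) → ∀ (lo hi : ℝ)
    (Φ : ℝ → EuclideanSpace ℝ (Fin 3) → ℝ) (U : ℝ → EuclideanSpace ℝ (Fin 3) → EuclideanSpace ℝ (Fin 3)),
    ContinuousOn (uncurry Φ) (Ioo lo hi ×ˢ O) →
    (∀ z ∈ Ioo lo hi ×ˢ O, ContDiffAt ℝ 2 (Φ z.1) z.2) →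
    ContinuousOn (fun z : ℝ × EuclideanSpace ℝ (Fin 3) => fderiv ℝ (Φ z.1) z.2) (Ioo lo hi ×ˢ O) →
    (∀ z ∈ Ioo lo hi ×ˢ O, DifferentiableAt ℝ (fun r => Φ r z.2) z.1) →
    ContinuousOn (fun z : ℝ × EuclideanSpace ℝ (Fin 3) => deriv (fun r => Φ r z.2) z.1) (Ioo lo hi ×ˢ O) →
    ContinuousOn (uncurry U) (Ioo lo hi ×ˢ O) →
    (∀ z ∈ Ioo lo hi ×ˢ O, ContDiffAt ℝ 1 (U z.1) z.2) →
    (∀ z ∈ Ioo lo hi ×ˢ O, VectorCalculus.divergence (U z.1) z.2 = 0) →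
    (∀ z ∈ Ioo lo hi ×ˢ O, 0 ≤ deriv (fun r => Φ r z.2) z.1 + fderiv ℝ (Φ z.1) z.2 (U z.1 z.2) +
      2 / cylRadius z.2 * partialDeriv (eR z.2) (Φ z.1) z.2 - (Laplacian.laplacian (Φ z.1)) z.2) →
    ∀ (H : ℝ → ℝ), ContDiff ℝ 2 H → (∀ v, deriv H v ≤ 0) → (∀ v, 0 ≤ H v) →
    (∀ v, 0 ≤ deriv (deriv H) v) → (∀ v, deriv H v ^ 2 ≤ 2 * H v * deriv (deriv H) v) →
    ∀ (Θ : EuclideanSpace ℝ (Fin 3) → ℝ), ContDiff ℝ 1 Θ → HasCompactSupport Θ → tsupport Θ ⊆ O →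
    ∀ (η : ℝ → ℝ), ContDiff ℝ 1 η → (∀ s, 0 ≤ η s) →
    ∀ (t₁ t : ℝ), lo < t₁ → t₁ ≤ t → t < hi →
    ∀ (M GH Pf TU Tb : ℝ → ℝ),
    (∀ s, M s = ∫ x, H (Φ s x) * Θ x ^ 2) →
    (∀ s, GH s = ∫ x, deriv (deriv H) (Φ s x) * ‖gradient (Φ s) x‖ ^ 2 * Θ x ^ 2) →
    (∀ s, Pf s = ∫ x, H (Φ s x) * ‖gradient Θ x‖ ^ 2) →
    (∀ s, TU s = ∫ x, H (Φ s x) * inner ℝ (U s x) (gradient (fun y => Θ y ^ 2) x)) →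
    (∀ s, Tb s = ∫ x, 2 / cylRadius x * (H (Φ s x) * fderiv ℝ (fun y => Θ y ^ 2) x (eR x))) →
    η t * M t + 1 / 2 * ∫ s in t₁..t, η s * GH s ≤
      η t₁ * M t₁ + ∫ s in t₁..t, (4 * (η s * Pf s) + η s * TU s + η s * Tb s + |deriv η s| * M s) := by
  intro O hO hOρ lo hi Φ U hΦc hΦs hΦg hΦt hΦt' hUc hUs hdivU hsup H hH hH' hH0 hH2 hκ Θ hΘ hΘc hΘO η hη hη0
    t₁ t h1 h1t ht M GH Pf TU Tb hM hGH hPf hTU hTb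
  obtain ⟨T₁, hT₁⟩ : ∃ T₁ : ℝ → ℝ, ∀ s, T₁ s = ∫ x, deriv H (Φ s x) *
      ⟪gradient (Φ s) x, gradient (fun y => Θ y ^ 2) x⟫ := ⟨_, fun _ => rfl⟩
  obtain ⟨D, hD⟩ : ∃ D : ℝ → ℝ, ∀ s, D s = ∫ x, deriv H (Φ s x) * deriv (fun r => Φ r x) s * Θ x ^ 2 := ⟨_, fun _ => rfl⟩
  have hmain := supersolution_energy_ineq_offAxis O hO hOρ lo hi Φ U hΦc hΦs hΦg hΦt hΦt' hUc hUs hdivU hsup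
    H hH hH' Θ hΘ hΘc hΘO η hη hη0 t₁ t h1 h1t ht M GH T₁ TU Tb hM hGH hT₁ hTU hTb
  obtain ⟨cM, cGH, cT₁, cPf, cTU, cTb, -⟩ := continuousOn_drift_sliceFunctionals O hO hOρ lo hi Φ U
    hΦc hΦg hΦt' hUc H hH Θ hΘ hΘc hΘO M GH T₁ Pf TU Tb D hM hGH hT₁ hPf hTU hTb hD
  set K : Set (EuclideanSpace ℝ (Fin 3)) := tsupport Θ with hKdef
  have hK : IsCompact K := hΘc
  have hΘ0 : ∀ x, x ∉ K → Θ x = 0 := fun x hx => image_eq_zero_of_notMem_tsupport hx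
  have hgΘ0 : ∀ x, x ∉ K → gradient (fun y => Θ y ^ 2) x = 0 := fun x hx => gradient_sq_eq_zero_of_notMem hx
  have hgΘ0' : ∀ x, x ∉ K → gradient Θ x = 0 := fun x hx => gradient_eq_zero_of_notMem_tsupport hx
  have hIcc : Icc t₁ t ⊆ Ioo lo hi := fun r hr => ⟨lt_of_lt_of_le h1 hr.1, lt_of_le_of_lt hr.2 ht⟩
  have hHd' : ContDiff ℝ 1 (deriv H) := by
    have h2' : ContDiff ℝ (1 + 1) H := by rw [one_add_one_eq_two]; exact hH
    exact h2'.deriv'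
  -- slice facts: `-T₁ ≤ ½ G_H + 4 P` and `M ≥ 0`
  have hslice : ∀ s ∈ Icc t₁ t, -T₁ s ≤ GH s / 2 + 4 * Pf s ∧ 0 ≤ M s := by
    intro s hs
    have hsI : s ∈ Ioo lo hi := hIcc hs
    have hF2 : ContDiffOn ℝ 2 (Φ s) O := fun x hx => (hΦs (s, x) ⟨hsI, hx⟩).contDiffWithinAt
    have hF1 : ContDiffOn ℝ 1 (Φ s) O := hF2.of_le (by norm_cast)
    have cF : ContinuousOn (Φ s) O := hF1.continuousOn
    have cgF : ContinuousOn (gradient (Φ s)) O := continuousOn_gradient_of_contDiffOn hO hF1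
    have cΘ2 : Continuous fun y : EuclideanSpace ℝ (Fin 3) => Θ y ^ 2 := hΘ.continuous.pow 2
    have cgΘ : Continuous (gradient Θ) := continuous_gradient_of_contDiff hΘ
    have cgΘ2 : Continuous (gradient fun y => Θ y ^ 2) := continuous_gradient_of_contDiff (hΘ.pow 2)
    have iGH : Integrable fun x => deriv (deriv H) (Φ s x) * ‖gradient (Φ s) x‖ ^ 2 * Θ x ^ 2 :=
      (continuous_integrable_of_continuousOn_of_eq_zero hO hK hΘO
        ((((hHd'.continuous_deriv le_rfl).comp_continuousOn cF).mul (cgF.norm.pow 2)).mul cΘ2.continuousOn)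
        (fun x hx => by simp [hΘ0 x hx])).2
    have iT₁ : Integrable fun x => deriv H (Φ s x) * ⟪gradient (Φ s) x, gradient (fun y => Θ y ^ 2) x⟫ :=
      (continuous_integrable_of_continuousOn_of_eq_zero hO hK hΘO
        ((hHd'.continuous.comp_continuousOn cF).mul (cgF.inner cgΘ2.continuousOn))
        (fun x hx => by
          show deriv H (Φ s x) * ⟪gradient (Φ s) x, gradient (fun y => Θ y ^ 2) x⟫ = 0; simp [hgΘ0 x hx])).2
    have iPf : Integrable fun x => H (Φ s x) * ‖gradient Θ x‖ ^ 2 :=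
      (continuous_integrable_of_continuousOn_of_eq_zero hO hK hΘO
        ((hH.continuous.comp_continuousOn cF).mul (cgΘ.norm.pow 2).continuousOn)
        (fun x hx => by simp [hgΘ0' x hx])).2
    refine ⟨?_, ?_⟩
    · rw [hT₁ s, hGH s, hPf s, ← MeasureTheory.integral_neg, ← MeasureTheory.integral_div,
        ← MeasureTheory.integral_const_mul,
        ← MeasureTheory.integral_add (iGH.div_const _) (iPf.const_mul _)]
      refine MeasureTheory.integral_mono iT₁.neg ((iGH.div_const _).add (iPf.const_mul _)) fun x => ?_
      exact neg_cross_le_pointwise hH0 hH2 hκ hΘ (Φ s) x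
    · rw [hM s]
      exact integral_nonneg fun x => mul_nonneg (hH0 _) (sq_nonneg _)
  -- integrate
  have hsub : uIcc t₁ t ⊆ Ioo lo hi := by rw [uIcc_of_le h1t]; exact hIcc
  obtain ⟨iiM, iiGH, iiT₁⟩ : IntervalIntegrable M volume t₁ t ∧ IntervalIntegrable GH volume t₁ t ∧
    IntervalIntegrable T₁ volume t₁ t := ⟨(cM.mono hsub).intervalIntegrable, (cGH.mono hsub).intervalIntegrable,
      (cT₁.mono hsub).intervalIntegrable⟩
  obtain ⟨iiPf, iiTU, iiTb⟩ : IntervalIntegrable Pf volume t₁ t ∧ IntervalIntegrable TU volume t₁ t ∧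
    IntervalIntegrable Tb volume t₁ t := ⟨(cPf.mono hsub).intervalIntegrable, (cTU.mono hsub).intervalIntegrable,
      (cTb.mono hsub).intervalIntegrable⟩
  have cη : Continuous η := hη.continuous
  have cη' : Continuous (deriv η) := hη.continuous_deriv le_rfl
  have iiη : ∀ {f : ℝ → ℝ}, IntervalIntegrable f volume t₁ t → IntervalIntegrable (fun s => η s * f s) volume t₁ t :=
    fun hf => hf.continuousOn_mul cη.continuousOn
  have hmaj : ∀ s ∈ Icc t₁ t, η s * (-(GH s + T₁ s) + TU s + Tb s) + deriv η s * M s ≤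
      -(1 / 2) * (η s * GH s) + (4 * (η s * Pf s) + η s * TU s + η s * Tb s + |deriv η s| * M s) := by
    intro s hs
    obtain ⟨hcross, hM0⟩ := hslice s hs
    have h1 : -(η s * T₁ s) ≤ η s * (GH s / 2 + 4 * Pf s) := by
      have := mul_le_mul_of_nonneg_left hcross (hη0 s)
      linarith
    have h2 : deriv η s * M s ≤ |deriv η s| * M s := mul_le_mul_of_nonneg_right (le_abs_self _) hM0
    nlinarith [h1, h2]
  have iL : IntervalIntegrable (fun s => η s * (-(GH s + T₁ s) + TU s + Tb s) + deriv η s * M s) volume t₁ t :=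
    (iiη (((iiGH.add iiT₁).neg.add iiTU).add iiTb)).add (iiM.continuousOn_mul cη'.continuousOn)
  have iR₂ : IntervalIntegrable (fun s => 4 * (η s * Pf s) + η s * TU s + η s * Tb s + |deriv η s| * M s) volume t₁ t :=
    ((((iiη iiPf).const_mul 4).add (iiη iiTU)).add (iiη iiTb)).add (iiM.continuousOn_mul cη'.abs.continuousOn)
  have iR : IntervalIntegrable (fun s => -(1 / 2) * (η s * GH s) +
      (4 * (η s * Pf s) + η s * TU s + η s * Tb s + |deriv η s| * M s)) volume t₁ t :=
    ((iiη iiGH).const_mul _).add iR₂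
  have hmono := intervalIntegral.integral_mono_on h1t iL iR hmaj
  have hsplit : ∫ s in t₁..t, (-(1 / 2) * (η s * GH s) +
        (4 * (η s * Pf s) + η s * TU s + η s * Tb s + |deriv η s| * M s)) =
      -(1 / 2) * (∫ s in t₁..t, η s * GH s) +
        ∫ s in t₁..t, (4 * (η s * Pf s) + η s * TU s + η s * Tb s + |deriv η s| * M s) := by
    rw [intervalIntegral.integral_add ((iiη iiGH).const_mul _) iR₂, intervalIntegral.integral_const_mul]
  rw [hsplit] at hmono
  linarith [hmono, hmain]

end Summit.NavierStokesRegularity.NavierStokesRegularity.Theorems.AxisymmetricKatoGlobal.EulerScaling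

end
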